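import Mathlib
import Literature.NumberTheory.Irrationality.BrownZudilin2022.GeneralFamily
import Summits.KontsevichZagierPeriods.Zeta5Search.JintegralMellinT
import Summits.KontsevichZagierPeriods.Zeta5Search.RhinViolaConjugation
import Summits.KontsevichZagierPeriods.Zeta5Search.CellularCubicalSubstitution
import Summits.KontsevichZagierPeriods.Zeta5Search.BarnesSymmetry
import HarnessLib

/-!
# ζ(5) search — Brown–Zudilin's generator `h` WITHOUT Bailey's transformation, and (27) for `h` (cell `pub-zeta5`, seat ct-1 g13)

HONEST FRAMING: systematic search; no irrationality claim unless kernel-certified. Nothing in this file is an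
irrationality result, a worthiness exponent or a denominator statement. Companion of `JintegralHprime.lean` for the second
hypergeometric generator `h : (p;q) ↦ (q₂, p₁, p₂−p₀+q₂, p₃−p₀+q₂, p₄−p₀+q₂, p₅−p₀+q₂, p₆−p₀+q₂; q₁−p₀+q₂, p₀, q₃, q₄, q₅)` of
Brown–Zudilin's group `G ≅ Σ₇` [BrownZudilin2022, Sect. 7, p. 18], which keeps `J(p;q)/(p₂!q₁!q₂!(p₆−p₀+q₂)!)` invariant. Route:
STEP 0 (`JintegralMellinT.Jintegral_mellin_T`) ∘ the Rhin–Viola word `σφϑϑϑϑφϑϑϑ` (`RhinViolaConjugation.rv_conj_h`: two Euler steps conjugated by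
changes of variables, so no condition `p₀ ≤ p₁+q₁` arises; the `z`-exponents are unchanged, the link exponent becomes `q₂+1`) ∘ STEP 7 (the weight `Γ(p₆+1+t)Γ(−t)·Γ(r₁−t)/Γ(−t)`, `r₁ = q₂−p₀`, is the weight of `h(p;q)` at `t−r₁`).

* `Jintegral_h` — `(q₁+q₂−p₀)!(p₂+q₂−p₀)!p₀!p₆!·J(p;q) = q₁!q₂!p₂!(p₆+q₂−p₀)!·J(h(p;q))` under (18b), (19) and the letters;
* **`normalisedIntegral'_genH`** — the `h`-conjunct of the named Literature fact `invariance_of_converges'` (BZ22 (27)) for EVERY `a` with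
  `a` and `ha` convergent (`p₀ = h₁₉(a) = h₅(ha) ≥ 0` is automatic).

Theorems only (no new definitions); no status word, no `γ`, nothing about ζ(5).
-/

noncomputable section

namespace Summit.KontsevichZagierPeriods.Zeta5Search.JintegralH

open MeasureTheory Set Filter
open scoped Real Nat
open Literature.NumberTheory.Irrationality.BrownZudilin2022
open Summit.KontsevichZagierPeriods.Zeta5Search.JintegralMellinT (Jintegral_mellin_T)
open Summit.KontsevichZagierPeriods.Zeta5Search.RhinViolaConjugation (rv_conj_h)
open Summit.KontsevichZagierPeriods.Zeta5Search.BarnesSymmetry (normF_pos)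
open Summit.KontsevichZagierPeriods.Zeta5Search.CellularCubicalSubstitution (cellularIntegral_eq_Jintegral)

/-! ### 1. `(q₁+q₂−p₀)!(p₂+q₂−p₀)!p₀!p₆!·J(p;q) = q₁!q₂!p₂!p₆'!·J(h(p;q))` -/

/-- **Brown–Zudilin's `h` for `J(p;q)`, Bailey-free.** Let `(p;q)`, `(p';q')` be integer parameters with `p' = h(p;q)` (entrywise:
`p'₀ = q₂`, `p'₁ = p₁`, `p'ᵢ + p₀ = pᵢ + q₂` for `i = 2,…,6`, `q'₁ + p₀ = q₁+q₂`, `q'₂ = p₀`, `q'₃,q'₄,q'₅` unchanged; printed indices),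
(18b) `p₃+q₃ = p₆+q₁+q₂`, (19) `p₃ = p₁+q₁`, naturals `p₀ = k₀`, `p₁ = k₁`, `q₁ = l₁`, `p₂ = k₂`, `q₂ = l₂`, `p₆ = m₆`, `p'₆ = n'`
with `k₀ ≤ l₁+l₂`, `k₀ ≤ k₂+l₂`, `q₃,q₄,q₅ ≥ 0`, and abscissae `c₂`, `c₂' = c₂+q₂−p₀` with
`max(0, p₆−q₃, p₀−q₂, p₀+p₁−p₂−q₂) < c₂ < min(p₄+1, p₅+1, p₆+1, p₃+2)`. Then
`(q₁+q₂−p₀)!·(p₂+q₂−p₀)!·p₀!·p₆!·J(p;q) = q₁!·q₂!·p₂!·p'₆!·J(p';q')`. [BrownZudilin2022, Sect. 7, p. 18 (`h`); RV §4] -/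
theorem Jintegral_h (p p' : Fin 7 → ℤ) (q q' : Fin 5 → ℤ) {k0 k1 l1 k2 l2 m₆ n' : ℕ}
    (hk0 : p 0 = k0) (hk1 : p 1 = k1) (hl1 : q 0 = l1) (hk2 : p 2 = k2) (hl2 : q 1 = l2) (hm : p 6 = m₆) (hn' : p' 6 = n')
    (hq2 : 0 ≤ q 2) (hq3 : 0 ≤ q 3) (hq4 : 0 ≤ q 4) (h18 : p 3 + q 2 = p 6 + q 0 + q 1) (h19 : p 3 = p 1 + q 0)
    (hq : k0 ≤ l1 + l2) (hk : k0 ≤ k2 + l2)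
    (e0 : p' 0 = q 1) (e1 : p' 1 = p 1) (e2 : p' 2 + p 0 = p 2 + q 1) (e3 : p' 3 + p 0 = p 3 + q 1) (e4 : p' 4 + p 0 = p 4 + q 1)
    (e5 : p' 5 + p 0 = p 5 + q 1) (e6 : p' 6 + p 0 = p 6 + q 1) (f0 : q' 0 + p 0 = q 0 + q 1) (f1 : q' 1 = p 0) (f2 : q' 2 = q 2)
    (f3 : q' 3 = q 3) (f4 : q' 4 = q 4) {c₂ c₂' : ℝ} (hc' : c₂' + k0 = c₂ + l2) (hc0 : 0 < c₂) (hc0' : 0 < c₂') (hc6 : c₂ < (m₆ : ℝ) + 1)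
    (hc4 : c₂ < (p 4 : ℝ) + 1) (hc5 : c₂ < (p 5 : ℝ) + 1) (hc3 : c₂ < (p 3 : ℝ) + 2) (hcr : (m₆ : ℝ) - q 2 < c₂)
    (hcB : (k0 : ℝ) + k1 - k2 - l2 < c₂) :
    (((l1 + l2 - k0)! * (k2 + l2 - k0)! * k0 ! * m₆ ! : ℕ) : ℝ) * Jintegral p q =
      ((l1 ! * l2 ! * k2 ! * n' ! : ℕ) : ℝ) * Jintegral p' q' := by
  -- integer / real / complex bookkeeping of the hypotheses
  have h18R : (p 3 : ℝ) + q 2 = p 6 + q 0 + q 1 := by exact_mod_cast h18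
  have h19R : (p 3 : ℝ) = p 1 + q 0 := by exact_mod_cast h19
  have hk0R : (p 0 : ℝ) = k0 := by rw [hk0]; rfl
  have hk1R : (p 1 : ℝ) = k1 := by rw [hk1]; rfl
  have hl1R : (q 0 : ℝ) = l1 := by rw [hl1]; rfl
  have hk2R : (p 2 : ℝ) = k2 := by rw [hk2]; rfl
  have hl2R : (q 1 : ℝ) = l2 := by rw [hl2]; rfl
  have hmR : (p 6 : ℝ) = m₆ := by rw [hm]; rfl
  have hn'R : (p' 6 : ℝ) = n' := by rw [hn']; rfl
  have e2R : (p' 2 : ℝ) + p 0 = p 2 + q 1 := by exact_mod_cast e2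
  have e3R : (p' 3 : ℝ) + p 0 = p 3 + q 1 := by exact_mod_cast e3
  have e4R : (p' 4 : ℝ) + p 0 = p 4 + q 1 := by exact_mod_cast e4
  have e5R : (p' 5 : ℝ) + p 0 = p 5 + q 1 := by exact_mod_cast e5
  have e6R : (p' 6 : ℝ) + p 0 = p 6 + q 1 := by exact_mod_cast e6
  have hqR : (k0 : ℝ) ≤ l1 + l2 := by exact_mod_cast hq
  have hkR : (k0 : ℝ) ≤ k2 + l2 := by exact_mod_cast hk
  have hq2R : (0 : ℝ) ≤ q 2 := by exact_mod_cast hq2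
  -- STEP 0 for `(p;q)` at `c₂` and for `(p';q')` at `c₂'`
  have hqv : ∀ j, 0 ≤ q j := by
    intro j; fin_cases j
    · simp [hl1]
    · simp [hl2]
    · exact hq2
    · exact hq3
    · exact hq4
  have hqv' : ∀ j, 0 ≤ q' j := by
    intro j; fin_cases j
    · simp only [Fin.zero_eta]; omega
    · simp [f1, hk0]
    · simp [f2]; exact hq2
    · simp [f3]; exact hq3
    · simp [f4]; exact hq4
  have hJ := Jintegral_mellin_T p q hqv hm (by rw [hk1]; positivity) (by rw [hk2]; positivity) hc0 hc6 hc4 hc5 hc3 hcr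
    (by linarith [h18R, h19R, hk0R, hk1R, hl1R, hl2R, hmR]) (by linarith [h18R, h19R, hk0R, hk1R, hk2R, hl1R, hl2R, hmR])
  have hJ' := Jintegral_mellin_T p' q' hqv' hn' (by rw [e1, hk1]; positivity) (by omega) (c₂ := c₂') hc0'
    (by rw [← hn'R]; linarith) (by linarith) (by linarith) (by linarith) (by rw [f2, ← hn'R]; linarith)
    (by rw [e0, e1, f2, hl2R, hk1R, ← hn'R]; linarith) (by rw [e0, f2, hl2R, ← hn'R]; linarith)
  -- complex-cast versions
  have hc'C : (c₂' : ℂ) + (k0 : ℂ) = (c₂ : ℂ) + (l2 : ℂ) := by exact_mod_cast hc'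
  have h18C : ((p 3 : ℤ) : ℂ) + ((q 2 : ℤ) : ℂ) = (m₆ : ℂ) + (l1 : ℂ) + (l2 : ℂ) := by
    have := h18; rw [hm, hl1, hl2] at this; exact_mod_cast this
  have h19C : ((p 3 : ℤ) : ℂ) = (k1 : ℂ) + (l1 : ℂ) := by
    have := h19; rw [hk1, hl1] at this; exact_mod_cast this
  have hn'C : (n' : ℂ) + (k0 : ℂ) = (m₆ : ℂ) + (l2 : ℂ) := by
    have := e6; rw [hn', hk0, hm, hl2] at this; exact_mod_cast this
  have e2C' : ((p' 2 : ℤ) : ℂ) + (k0 : ℂ) = (k2 : ℂ) + (l2 : ℂ) := by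
    have := e2; rw [hk2, hl2, hk0] at this; exact_mod_cast this
  have e2C : ((p' 2 : ℤ) : ℂ) = (k2 : ℂ) + (l2 : ℂ) - (k0 : ℂ) := by linear_combination e2C'
  have e3C : ((p' 3 : ℤ) : ℂ) + (k0 : ℂ) = ((p 3 : ℤ) : ℂ) + (l2 : ℂ) := by
    have := e3; rw [hk0, hl2] at this; exact_mod_cast this
  have e4C : ((p' 4 : ℤ) : ℂ) + (k0 : ℂ) = ((p 4 : ℤ) : ℂ) + (l2 : ℂ) := by
    have := e4; rw [hk0, hl2] at this; exact_mod_cast this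
  have e5C : ((p' 5 : ℤ) : ℂ) + (k0 : ℂ) = ((p 5 : ℤ) : ℂ) + (l2 : ℂ) := by
    have := e5; rw [hk0, hl2] at this; exact_mod_cast this
  have f0C' : ((q' 0 : ℤ) : ℂ) + (k0 : ℂ) = (l1 : ℂ) + (l2 : ℂ) := by
    have := f0; rw [hk0, hl1, hl2] at this; exact_mod_cast this
  have f0C : ((q' 0 : ℤ) : ℂ) = (l1 : ℂ) + (l2 : ℂ) - (k0 : ℂ) := by linear_combination f0C'
  have a0 : ((p 0 : ℤ) : ℂ) = (k0 : ℂ) := by rw [hk0]; rfl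
  have a1 : ((p 1 : ℤ) : ℂ) = (k1 : ℂ) := by rw [hk1]; rfl
  have a2 : ((q 0 : ℤ) : ℂ) = (l1 : ℂ) := by rw [hl1]; rfl
  have a3 : ((p 2 : ℤ) : ℂ) = (k2 : ℂ) := by rw [hk2]; rfl
  have a4 : ((q 1 : ℤ) : ℂ) = (l2 : ℂ) := by rw [hl2]; rfl
  have b0 : ((p' 0 : ℤ) : ℂ) = (l2 : ℂ) := by rw [e0, hl2]; rfl
  have b1 : ((p' 1 : ℤ) : ℂ) = (k1 : ℂ) := by rw [e1, hk1]; rfl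
  have b3 : ((q' 1 : ℤ) : ℂ) = (k0 : ℂ) := by rw [f1, hk0]; rfl
  have b4 : ((q' 2 : ℤ) : ℂ) = ((q 2 : ℤ) : ℂ) := by rw [f2]
  have b5 : ((q' 3 : ℤ) : ℂ) = ((q 3 : ℤ) : ℂ) := by rw [f3]
  have b6 : ((q' 4 : ℤ) : ℂ) = ((q 4 : ℤ) : ℂ) := by rw [f4]
  -- rewrite the composite exponents / Gamma arguments (universally in `η`, so that `simp only` rewrites under the integral)
  have r1 : ∀ η : ℝ, ((q 2 : ℤ) : ℂ) - (m₆ : ℂ) - 1 - (-(c₂ : ℂ) + (η : ℂ) * Complex.I) =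
      (l1 : ℂ) + (l2 : ℂ) - (((p 3 : ℤ) : ℂ) + 1 + (-(c₂ : ℂ) + (η : ℂ) * Complex.I)) := by
    intro η; linear_combination h18C
  have r2 : ∀ η : ℝ, ((p' 3 : ℤ) : ℂ) + 1 + (-(c₂' : ℂ) + (η : ℂ) * Complex.I) =
      ((p 3 : ℤ) : ℂ) + 1 + (-(c₂ : ℂ) + (η : ℂ) * Complex.I) := by
    intro η; linear_combination e3C - hc'C
  have r3 : ∀ η : ℝ, ((q' 2 : ℤ) : ℂ) - (n' : ℂ) - 1 - (-(c₂' : ℂ) + (η : ℂ) * Complex.I) =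
      (l1 : ℂ) + (l2 : ℂ) - (((p 3 : ℤ) : ℂ) + 1 + (-(c₂ : ℂ) + (η : ℂ) * Complex.I)) := by
    intro η; linear_combination b4 + h18C - hn'C + hc'C
  have r4 : ∀ η : ℝ, ((p' 5 : ℤ) : ℂ) + 1 + (-(c₂' : ℂ) + (η : ℂ) * Complex.I) =
      ((p 5 : ℤ) : ℂ) + 1 + (-(c₂ : ℂ) + (η : ℂ) * Complex.I) := by
    intro η; linear_combination e5C - hc'C
  have r5 : ∀ η : ℝ, ((p' 5 : ℤ) : ℂ) + ((q' 4 : ℤ) : ℂ) + 2 + (-(c₂' : ℂ) + (η : ℂ) * Complex.I) =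
      ((p 5 : ℤ) : ℂ) + ((q 4 : ℤ) : ℂ) + 2 + (-(c₂ : ℂ) + (η : ℂ) * Complex.I) := by
    intro η; linear_combination e5C + b6 - hc'C
  have r6 : ∀ η : ℝ, ((p' 4 : ℤ) : ℂ) + 1 + (-(c₂' : ℂ) + (η : ℂ) * Complex.I) =
      ((p 4 : ℤ) : ℂ) + 1 + (-(c₂ : ℂ) + (η : ℂ) * Complex.I) := by
    intro η; linear_combination e4C - hc'C
  have r7 : ∀ η : ℝ, ((p' 4 : ℤ) : ℂ) + ((q' 3 : ℤ) : ℂ) + 2 + (-(c₂' : ℂ) + (η : ℂ) * Complex.I) =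
      ((p 4 : ℤ) : ℂ) + ((q 3 : ℤ) : ℂ) + 2 + (-(c₂ : ℂ) + (η : ℂ) * Complex.I) := by
    intro η; linear_combination e4C + b5 - hc'C
  have r8 : ∀ η : ℝ, (n' : ℂ) + 1 + (-(c₂' : ℂ) + (η : ℂ) * Complex.I) =
      (m₆ : ℂ) + 1 + (-(c₂ : ℂ) + (η : ℂ) * Complex.I) := by
    intro η; linear_combination hn'C - hc'C
  have r9 : ∀ η : ℝ, -(-(c₂' : ℂ) + (η : ℂ) * Complex.I) =
      ((l2 : ℂ) - (k0 : ℂ)) - (-(c₂ : ℂ) + (η : ℂ) * Complex.I) := by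
    intro η; linear_combination hc'C
  simp only [r1, a0, a1, a2, a3, a4] at hJ
  simp only [r2, r3, r4, r5, r6, r7, r8, r9] at hJ'
  simp only [b0, b1, b3, b5, b6, e2C, f0C] at hJ'
  -- the pointwise identity of the two integrands
  have key : ∀ η : ℝ,
      ((((l1 + l2 - k0)! * (k2 + l2 - k0)! * k0 ! * m₆ ! : ℕ) : ℝ) : ℂ) *
        ((Complex.Gamma (((p 5 : ℤ) : ℂ) + 1 + (-(c₂ : ℂ) + (η : ℂ) * Complex.I)) * Complex.Gamma (((q 4 : ℤ) : ℂ) + 1) /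
            Complex.Gamma (((p 5 : ℤ) : ℂ) + ((q 4 : ℤ) : ℂ) + 2 + (-(c₂ : ℂ) + (η : ℂ) * Complex.I))) *
        ((Complex.Gamma (((p 4 : ℤ) : ℂ) + 1 + (-(c₂ : ℂ) + (η : ℂ) * Complex.I)) * Complex.Gamma (((q 3 : ℤ) : ℂ) + 1) /
            Complex.Gamma (((p 4 : ℤ) : ℂ) + ((q 3 : ℤ) : ℂ) + 2 + (-(c₂ : ℂ) + (η : ℂ) * Complex.I))) *
        ∫ x in (univ.pi fun _ : Fin 3 => Ioo (0:ℝ) 1),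
          ((x 0 : ℝ) : ℂ) ^ ((k1 : ℂ)) * ((1 - x 0 : ℝ) : ℂ) ^ ((l1 : ℂ)) * ((x 1 : ℝ) : ℂ) ^ ((k2 : ℂ)) *
            ((1 - x 1 : ℝ) : ℂ) ^ ((l2 : ℂ)) * ((x 2 : ℝ) : ℂ) ^ (((p 3 : ℤ) : ℂ) + 1 + (-(c₂ : ℂ) + (η : ℂ) * Complex.I)) *
            ((1 - x 2 : ℝ) : ℂ) ^ ((l1 : ℂ) + (l2 : ℂ) - (((p 3 : ℤ) : ℂ) + 1 + (-(c₂ : ℂ) + (η : ℂ) * Complex.I))) /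
            ((1 - (1 - x 0 * x 1) * x 2 : ℝ) : ℂ) ^ ((k0 : ℂ) + 1)) *
        (Complex.Gamma ((m₆ : ℂ) + 1 + (-(c₂ : ℂ) + (η : ℂ) * Complex.I)) *
            Complex.Gamma (-(-(c₂ : ℂ) + (η : ℂ) * Complex.I)) / (m₆.factorial : ℂ))) =
      ((((l1 ! * l2 ! * k2 ! * n' ! : ℕ) : ℝ)) : ℂ) *
        ((Complex.Gamma (((p 5 : ℤ) : ℂ) + 1 + (-(c₂ : ℂ) + (η : ℂ) * Complex.I)) * Complex.Gamma (((q 4 : ℤ) : ℂ) + 1) /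
            Complex.Gamma (((p 5 : ℤ) : ℂ) + ((q 4 : ℤ) : ℂ) + 2 + (-(c₂ : ℂ) + (η : ℂ) * Complex.I))) *
        ((Complex.Gamma (((p 4 : ℤ) : ℂ) + 1 + (-(c₂ : ℂ) + (η : ℂ) * Complex.I)) * Complex.Gamma (((q 3 : ℤ) : ℂ) + 1) /
            Complex.Gamma (((p 4 : ℤ) : ℂ) + ((q 3 : ℤ) : ℂ) + 2 + (-(c₂ : ℂ) + (η : ℂ) * Complex.I))) *
        ∫ x in (univ.pi fun _ : Fin 3 => Ioo (0:ℝ) 1),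
          ((x 0 : ℝ) : ℂ) ^ ((k1 : ℂ)) * ((1 - x 0 : ℝ) : ℂ) ^ ((l1 : ℂ) + (l2 : ℂ) - (k0 : ℂ)) *
            ((x 1 : ℝ) : ℂ) ^ ((k2 : ℂ) + (l2 : ℂ) - (k0 : ℂ)) * ((1 - x 1 : ℝ) : ℂ) ^ ((k0 : ℂ)) *
            ((x 2 : ℝ) : ℂ) ^ (((p 3 : ℤ) : ℂ) + 1 + (-(c₂ : ℂ) + (η : ℂ) * Complex.I)) *
            ((1 - x 2 : ℝ) : ℂ) ^ ((l1 : ℂ) + (l2 : ℂ) - (((p 3 : ℤ) : ℂ) + 1 + (-(c₂ : ℂ) + (η : ℂ) * Complex.I))) /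
            ((1 - (1 - x 0 * x 1) * x 2 : ℝ) : ℂ) ^ ((l2 : ℂ) + 1)) *
        (Complex.Gamma ((m₆ : ℂ) + 1 + (-(c₂ : ℂ) + (η : ℂ) * Complex.I)) *
            Complex.Gamma (((l2 : ℂ) - (k0 : ℂ)) - (-(c₂ : ℂ) + (η : ℂ) * Complex.I)) / (n'.factorial : ℂ))) := by
    intro η
    set t : ℂ := -(c₂ : ℂ) + (η : ℂ) * Complex.I with ht_def
    have ht : t.re = -c₂ := by simp [ht_def]
    have hw := rv_conj_h k0 k1 l1 k2 l2 hq hk (((p 3 : ℤ) : ℂ) + 1 + t) (by simp [ht]; linarith)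
      (by simp [ht]; linarith [h18R, h19R, hk1R, hl1R, hl2R, hmR, hcr])
      (by simp [ht]; linarith [h19R, hk1R, hl1R])
      (by simp [ht]; linarith [h19R, hk1R, hl1R, hk0R, hl2R, hc0', hc'])
      (by simp [ht]; linarith [h19R, hk1R, hl1R, hk0R, hl2R, hk2R])
    rw [show (k1 : ℂ) + l1 - (((p 3 : ℤ) : ℂ) + 1 + t) + 1 = -t by linear_combination -h19C,
      show (l1 : ℂ) + l2 - (((p 3 : ℤ) : ℂ) + 1 + t) + k1 - k0 + 1 = ((l2 : ℂ) - (k0 : ℂ)) - t by linear_combination -h19C,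
      show (l1 : ℂ) + l2 - k0 + 1 = ((l1 + l2 - k0 : ℕ) : ℂ) + 1 by push_cast [hq]; ring,
      show (k2 : ℂ) + l2 - k0 + 1 = ((k2 + l2 - k0 : ℕ) : ℂ) + 1 by push_cast [hk]; ring,
      Complex.Gamma_nat_eq_factorial, Complex.Gamma_nat_eq_factorial, Complex.Gamma_nat_eq_factorial,
      Complex.Gamma_nat_eq_factorial, Complex.Gamma_nat_eq_factorial, Complex.Gamma_nat_eq_factorial] at hw
    generalize (∫ x in (univ.pi fun _ : Fin 3 => Ioo (0:ℝ) 1),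
          ((x 0 : ℝ) : ℂ) ^ ((k1 : ℂ)) * ((1 - x 0 : ℝ) : ℂ) ^ ((l1 : ℂ)) * ((x 1 : ℝ) : ℂ) ^ ((k2 : ℂ)) *
            ((1 - x 1 : ℝ) : ℂ) ^ ((l2 : ℂ)) * ((x 2 : ℝ) : ℂ) ^ (((p 3 : ℤ) : ℂ) + 1 + t) *
            ((1 - x 2 : ℝ) : ℂ) ^ ((l1 : ℂ) + (l2 : ℂ) - (((p 3 : ℤ) : ℂ) + 1 + t)) /
            ((1 - (1 - x 0 * x 1) * x 2 : ℝ) : ℂ) ^ ((k0 : ℂ) + 1)) = T0 at hw ⊢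
    generalize (∫ x in (univ.pi fun _ : Fin 3 => Ioo (0:ℝ) 1),
          ((x 0 : ℝ) : ℂ) ^ ((k1 : ℂ)) * ((1 - x 0 : ℝ) : ℂ) ^ ((l1 : ℂ) + (l2 : ℂ) - (k0 : ℂ)) *
            ((x 1 : ℝ) : ℂ) ^ ((k2 : ℂ) + (l2 : ℂ) - (k0 : ℂ)) * ((1 - x 1 : ℝ) : ℂ) ^ ((k0 : ℂ)) *
            ((x 2 : ℝ) : ℂ) ^ (((p 3 : ℤ) : ℂ) + 1 + t) *
            ((1 - x 2 : ℝ) : ℂ) ^ ((l1 : ℂ) + (l2 : ℂ) - (((p 3 : ℤ) : ℂ) + 1 + t)) /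
            ((1 - (1 - x 0 * x 1) * x 2 : ℝ) : ℂ) ^ ((l2 : ℂ) + 1)) = T6 at hw ⊢
    have hfac : ((m₆ ! : ℕ) : ℂ) ≠ 0 := by exact_mod_cast Nat.factorial_ne_zero _
    have hfac' : ((n' ! : ℕ) : ℂ) ≠ 0 := by exact_mod_cast Nat.factorial_ne_zero _
    have u1 : ((m₆ ! : ℕ) : ℂ) * ((m₆ ! : ℕ) : ℂ)⁻¹ = 1 := mul_inv_cancel₀ hfac
    have u2 : ((n' ! : ℕ) : ℂ) * ((n' ! : ℕ) : ℂ)⁻¹ = 1 := mul_inv_cancel₀ hfac'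
    simp only [div_eq_mul_inv]
    push_cast
    linear_combination (Complex.Gamma (((p 5 : ℤ) : ℂ) + 1 + t) * Complex.Gamma (((q 4 : ℤ) : ℂ) + 1) *
        (Complex.Gamma (((p 5 : ℤ) : ℂ) + ((q 4 : ℤ) : ℂ) + 2 + t))⁻¹ * (Complex.Gamma (((p 4 : ℤ) : ℂ) + 1 + t) *
        Complex.Gamma (((q 3 : ℤ) : ℂ) + 1) * (Complex.Gamma (((p 4 : ℤ) : ℂ) + ((q 3 : ℤ) : ℂ) + 2 + t))⁻¹) *
        Complex.Gamma ((m₆ : ℂ) + 1 + t)) * hw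
      + (Complex.Gamma (((p 5 : ℤ) : ℂ) + 1 + t) * Complex.Gamma (((q 4 : ℤ) : ℂ) + 1) *
        (Complex.Gamma (((p 5 : ℤ) : ℂ) + ((q 4 : ℤ) : ℂ) + 2 + t))⁻¹ * (Complex.Gamma (((p 4 : ℤ) : ℂ) + 1 + t) *
        Complex.Gamma (((q 3 : ℤ) : ℂ) + 1) * (Complex.Gamma (((p 4 : ℤ) : ℂ) + ((q 3 : ℤ) : ℂ) + 2 + t))⁻¹) *
        Complex.Gamma ((m₆ : ℂ) + 1 + t) *
        ((((l1 + l2 - k0)! : ℕ) : ℂ) * Complex.Gamma (-t) * (((k2 + l2 - k0)! : ℕ) : ℂ) * ((k0 ! : ℕ) : ℂ) * T0)) * u1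
      - (Complex.Gamma (((p 5 : ℤ) : ℂ) + 1 + t) * Complex.Gamma (((q 4 : ℤ) : ℂ) + 1) *
        (Complex.Gamma (((p 5 : ℤ) : ℂ) + ((q 4 : ℤ) : ℂ) + 2 + t))⁻¹ * (Complex.Gamma (((p 4 : ℤ) : ℂ) + 1 + t) *
        Complex.Gamma (((q 3 : ℤ) : ℂ) + 1) * (Complex.Gamma (((p 4 : ℤ) : ℂ) + ((q 3 : ℤ) : ℂ) + 2 + t))⁻¹) *
        Complex.Gamma ((m₆ : ℂ) + 1 + t) *
        (((l1 ! : ℕ) : ℂ) * Complex.Gamma (((l2 : ℂ) - (k0 : ℂ)) - t) * ((l2 ! : ℕ) : ℂ) * ((k2 ! : ℕ) : ℂ) * T6)) * u2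
  -- integrate
  have hC : ((((l1 + l2 - k0)! * (k2 + l2 - k0)! * k0 ! * m₆ ! : ℕ) : ℝ) : ℂ) * (Jintegral p q : ℂ) =
      ((((l1 ! * l2 ! * k2 ! * n' ! : ℕ) : ℝ)) : ℂ) * (Jintegral p' q' : ℂ) := by
    rw [hJ, hJ', mul_left_comm ((((l1 + l2 - k0)! * (k2 + l2 - k0)! * k0 ! * m₆ ! : ℕ) : ℝ) : ℂ),
      mul_left_comm ((((l1 ! * l2 ! * k2 ! * n' ! : ℕ) : ℝ)) : ℂ),
      ← integral_const_mul ((((l1 + l2 - k0)! * (k2 + l2 - k0)! * k0 ! * m₆ ! : ℕ) : ℝ) : ℂ),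
      ← integral_const_mul ((((l1 ! * l2 ! * k2 ! * n' ! : ℕ) : ℝ)) : ℂ)]
    congr 1
    exact integral_congr_ae (Eventually.of_forall key)
  exact_mod_cast hC

/-! ### 2. (27) for `h` -/

/-- Bookkeeping of `∏_{i∈F} h_i!` under `h`: the multiset `{h_i(ha)}_{i∈F}` is `{h_i(a)}_{i∈F}` with `q₁, q₂, p₂, p₆−p₀+q₂` replaced by
`q₁+q₂−p₀, p₂+q₂−p₀, p₀, p₆`. [BrownZudilin2022, Sect. 7, (26)–(27)] -/
theorem normF_genH (a : Fin 8 → ℤ) :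
    ((Fset.map fun i => ((hForm (genH a) i).toNat.factorial : ℝ)).prod) *
        (((qOf a 0).toNat.factorial * (qOf a 1).toNat.factorial * (pOf a 2).toNat.factorial *
          (pOf a 6 + qOf a 1 - pOf a 0).toNat.factorial : ℕ) : ℝ) =
      ((Fset.map fun i => ((hForm a i).toNat.factorial : ℝ)).prod) *
        (((qOf a 0 + qOf a 1 - pOf a 0).toNat.factorial * (pOf a 2 + qOf a 1 - pOf a 0).toNat.factorial *
          (pOf a 0).toNat.factorial * (pOf a 6).toNat.factorial : ℕ) : ℝ) := by
  simp [Fset, hForm, hList, genH, pOf, qOf]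
  ring_nf

/-- **`I` under `h`** (letters of `a`): `I(ha)·q₁!q₂!p₂!(p₆+q₂−p₀)! = I(a)·(q₁+q₂−p₀)!(p₂+q₂−p₀)!p₀!p₆!`, for EVERY pair `a`, `ha` of
convergent exponents. [BrownZudilin2022, Sect. 7, p. 18] -/
theorem cellularIntegral_genH {a : Fin 8 → ℤ} (ha : Converges a) (hga : Converges (genH a)) :
    cellularIntegral (genH a) * (((qOf a 0).toNat.factorial * (qOf a 1).toNat.factorial * (pOf a 2).toNat.factorial *
          (pOf a 6 + qOf a 1 - pOf a 0).toNat.factorial : ℕ) : ℝ) =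
      cellularIntegral a * (((qOf a 0 + qOf a 1 - pOf a 0).toNat.factorial * (pOf a 2 + qOf a 1 - pOf a 0).toNat.factorial *
          (pOf a 0).toNat.factorial * (pOf a 6).toNat.factorial : ℕ) : ℝ) := by
  have hA := ha
  have hB := hga
  simp only [Converges, convergenceForms, genH, List.mem_cons, List.not_mem_nil, or_false, forall_eq_or_imp, forall_eq,
    Matrix.cons_val_zero, Matrix.cons_val_one, Matrix.cons_val] at hA hB
  obtain ⟨g0, g1, g2, g3, g4, g5, g6, g7, g8, g9, g10, g11, g12, g13, g14, g15, g16⟩ := hA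
  obtain ⟨g0', g1', g2', g3', g4', g5', g6', g7', g8', g9', g10', g11', g12', g13', g14', g15', g16'⟩ := hB
  -- the naturals
  obtain ⟨k0, hk0⟩ := Int.eq_ofNat_of_zero_le (show 0 ≤ pOf a 0 by simp [pOf]; omega)
  obtain ⟨k1, hk1⟩ := Int.eq_ofNat_of_zero_le (show 0 ≤ pOf a 1 by simp [pOf]; omega)
  obtain ⟨l1, hl1⟩ := Int.eq_ofNat_of_zero_le (show 0 ≤ qOf a 0 by simp [qOf]; omega)
  obtain ⟨k2, hk2⟩ := Int.eq_ofNat_of_zero_le (show 0 ≤ pOf a 2 by simp [pOf]; omega)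
  obtain ⟨l2, hl2⟩ := Int.eq_ofNat_of_zero_le (show 0 ≤ qOf a 1 by simp [qOf]; omega)
  obtain ⟨m₆, hm⟩ := Int.eq_ofNat_of_zero_le (show 0 ≤ pOf a 6 by simp [pOf]; omega)
  obtain ⟨n', hn'⟩ := Int.eq_ofNat_of_zero_le (show 0 ≤ pOf (genH a) 6 by simp [pOf, genH]; omega)
  have hq : k0 ≤ l1 + l2 := by
    have : pOf a 0 ≤ qOf a 0 + qOf a 1 := by simp [pOf, qOf]; omega
    rw [hk0, hl1, hl2] at this; exact_mod_cast this
  have hk : k0 ≤ k2 + l2 := by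
    have : pOf a 0 ≤ pOf a 2 + qOf a 1 := by simp [pOf, qOf]; omega
    rw [hk0, hk2, hl2] at this; exact_mod_cast this
  -- the abscissa
  have i1 : pOf a 6 - qOf a 2 < pOf a 4 + 1 := by simp [pOf, qOf]; omega
  have i2 : pOf a 6 - qOf a 2 < pOf a 5 + 1 := by simp [pOf, qOf]; omega
  have i3 : pOf a 6 - qOf a 2 < pOf a 3 + 2 := by simp [pOf, qOf]; omega
  have i4 : pOf a 0 - qOf a 1 < pOf a 6 + 1 := by simp [pOf, qOf]; omega
  have i5 : pOf a 0 - qOf a 1 < pOf a 4 + 1 := by simp [pOf, qOf]; omega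
  have i6 : pOf a 0 - qOf a 1 < pOf a 5 + 1 := by simp [pOf, qOf]; omega
  have i7 : pOf a 0 - qOf a 1 < pOf a 3 + 2 := by simp [pOf, qOf]; omega
  have i8 : pOf a 0 + pOf a 1 - pOf a 2 - qOf a 1 < pOf a 6 + 1 := by simp [pOf, qOf]; omega
  have i9 : pOf a 0 + pOf a 1 - pOf a 2 - qOf a 1 < pOf a 4 + 1 := by simp [pOf, qOf]; omega
  have i10 : pOf a 0 + pOf a 1 - pOf a 2 - qOf a 1 < pOf a 5 + 1 := by simp [pOf, qOf]; omega
  have i11 : pOf a 0 + pOf a 1 - pOf a 2 - qOf a 1 < pOf a 3 + 2 := by simp [pOf, qOf]; omega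
  have i12 : 0 < pOf a 4 + 1 := by simp [pOf]; omega
  have i13 : 0 < pOf a 5 + 1 := by simp [pOf]; omega
  have i14 : 0 < pOf a 3 + 2 := by simp [pOf]; omega
  have i15 : 0 ≤ qOf a 2 := by simp [qOf]; omega
  have I1 : ((pOf a 6 : ℤ) : ℝ) - qOf a 2 < pOf a 4 + 1 := by exact_mod_cast i1
  have I2 : ((pOf a 6 : ℤ) : ℝ) - qOf a 2 < pOf a 5 + 1 := by exact_mod_cast i2
  have I3 : ((pOf a 6 : ℤ) : ℝ) - qOf a 2 < pOf a 3 + 2 := by exact_mod_cast i3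
  have I4 : ((pOf a 0 : ℤ) : ℝ) - qOf a 1 < pOf a 6 + 1 := by exact_mod_cast i4
  have I5 : ((pOf a 0 : ℤ) : ℝ) - qOf a 1 < pOf a 4 + 1 := by exact_mod_cast i5
  have I6 : ((pOf a 0 : ℤ) : ℝ) - qOf a 1 < pOf a 5 + 1 := by exact_mod_cast i6
  have I7 : ((pOf a 0 : ℤ) : ℝ) - qOf a 1 < pOf a 3 + 2 := by exact_mod_cast i7
  have I8 : ((pOf a 0 : ℤ) : ℝ) + pOf a 1 - pOf a 2 - qOf a 1 < pOf a 6 + 1 := by exact_mod_cast i8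
  have I9 : ((pOf a 0 : ℤ) : ℝ) + pOf a 1 - pOf a 2 - qOf a 1 < pOf a 4 + 1 := by exact_mod_cast i9
  have I10 : ((pOf a 0 : ℤ) : ℝ) + pOf a 1 - pOf a 2 - qOf a 1 < pOf a 5 + 1 := by exact_mod_cast i10
  have I11 : ((pOf a 0 : ℤ) : ℝ) + pOf a 1 - pOf a 2 - qOf a 1 < pOf a 3 + 2 := by exact_mod_cast i11
  have I12 : (0 : ℝ) < pOf a 4 + 1 := by exact_mod_cast i12
  have I13 : (0 : ℝ) < pOf a 5 + 1 := by exact_mod_cast i13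
  have I14 : (0 : ℝ) < pOf a 3 + 2 := by exact_mod_cast i14
  have I15 : (0 : ℝ) ≤ qOf a 2 := by exact_mod_cast i15
  have hmR : ((pOf a 6 : ℤ) : ℝ) = m₆ := by rw [hm]; rfl
  have hk0R : ((pOf a 0 : ℤ) : ℝ) = k0 := by rw [hk0]; rfl
  have hk1R : ((pOf a 1 : ℤ) : ℝ) = k1 := by rw [hk1]; rfl
  have hk2R : ((pOf a 2 : ℤ) : ℝ) = k2 := by rw [hk2]; rfl
  have hl2R : ((qOf a 1 : ℤ) : ℝ) = l2 := by rw [hl2]; rfl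
  have hm0 : (0 : ℝ) ≤ m₆ := m₆.cast_nonneg
  have I16 : (0 : ℝ) < pOf a 6 + 1 := by rw [hmR]; linarith
  have I17 : ((pOf a 6 : ℤ) : ℝ) - qOf a 2 < pOf a 6 + 1 := by linarith
  obtain ⟨c₂, hlo, hhi⟩ := exists_between (show max (max (0 : ℝ) ((pOf a 6 : ℝ) - qOf a 2))
      (max ((pOf a 0 : ℝ) - qOf a 1) ((pOf a 0 : ℝ) + pOf a 1 - pOf a 2 - qOf a 1)) <
      min (min ((pOf a 6 : ℝ) + 1) ((pOf a 4 : ℝ) + 1)) (min ((pOf a 5 : ℝ) + 1) ((pOf a 3 : ℝ) + 2)) from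
    max_lt (max_lt (lt_min (lt_min I16 I12) (lt_min I13 I14)) (lt_min (lt_min I17 I1) (lt_min I2 I3)))
      (max_lt (lt_min (lt_min I4 I5) (lt_min I6 I7)) (lt_min (lt_min I8 I9) (lt_min I10 I11))))
  simp only [max_lt_iff, lt_min_iff] at hlo hhi
  obtain ⟨⟨hc0, hcr⟩, hcA, hcB⟩ := hlo
  obtain ⟨⟨hc6, hc4⟩, hc5, hc3⟩ := hhi
  -- the identity for `J`
  have hJ := Jintegral_h (pOf a) (pOf (genH a)) (qOf a) (qOf (genH a)) hk0 hk1 hl1 hk2 hl2 hm hn' i15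
    (by simp only [qOf, Matrix.cons_val]; omega) (by simp only [qOf, Matrix.cons_val]; omega)
    (by simp only [pOf, qOf, Matrix.cons_val_zero, Matrix.cons_val_one, Matrix.cons_val]; omega)
    (by simp only [pOf, qOf, Matrix.cons_val_zero, Matrix.cons_val_one, Matrix.cons_val]; omega) hq hk
    (by simp only [pOf, qOf, genH, Matrix.cons_val_zero, Matrix.cons_val_one, Matrix.cons_val]; omega)
    (by simp only [pOf, genH, Matrix.cons_val_zero, Matrix.cons_val_one, Matrix.cons_val]; omega)
    (by simp only [pOf, qOf, genH, Matrix.cons_val_zero, Matrix.cons_val_one, Matrix.cons_val]; omega)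
    (by simp only [pOf, qOf, genH, Matrix.cons_val_zero, Matrix.cons_val_one, Matrix.cons_val]; omega)
    (by simp only [pOf, qOf, genH, Matrix.cons_val_zero, Matrix.cons_val_one, Matrix.cons_val]; omega)
    (by simp only [pOf, qOf, genH, Matrix.cons_val_zero, Matrix.cons_val_one, Matrix.cons_val]; omega)
    (by simp only [pOf, qOf, genH, Matrix.cons_val_zero, Matrix.cons_val_one, Matrix.cons_val]; omega)
    (by simp only [pOf, qOf, genH, Matrix.cons_val_zero, Matrix.cons_val_one, Matrix.cons_val]; omega)
    (by simp only [pOf, qOf, genH, Matrix.cons_val_zero, Matrix.cons_val_one, Matrix.cons_val])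
    (by simp only [qOf, genH, Matrix.cons_val_zero, Matrix.cons_val_one, Matrix.cons_val]; omega)
    (by simp only [qOf, genH, Matrix.cons_val_zero, Matrix.cons_val_one, Matrix.cons_val])
    (by simp only [qOf, genH, Matrix.cons_val_zero, Matrix.cons_val_one, Matrix.cons_val])
    (c₂ := c₂) (c₂' := c₂ + ((l2 : ℝ) - k0)) (by ring) hc0 (by rw [hk0R, hl2R] at hcA; linarith)
    (by rw [hmR] at hc6; linarith) hc4 hc5 hc3 (by rw [hmR] at hcr; linarith)
    (by rw [hk0R, hk1R, hk2R, hl2R] at hcB; linarith)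
  rw [cellularIntegral_eq_Jintegral, cellularIntegral_eq_Jintegral]
  have t1 : (qOf a 0).toNat = l1 := by rw [hl1]; rfl
  have t2 : (qOf a 1).toNat = l2 := by rw [hl2]; rfl
  have t3 : (pOf a 2).toNat = k2 := by rw [hk2]; rfl
  have t4 : (pOf a 6 + qOf a 1 - pOf a 0).toNat = n' := by
    have : pOf (genH a) 6 = pOf a 6 + qOf a 1 - pOf a 0 := by
      simp only [pOf, qOf, genH, Matrix.cons_val_zero, Matrix.cons_val_one, Matrix.cons_val]; omega
    rw [← this, hn']; rfl
  have t5 : (qOf a 0 + qOf a 1 - pOf a 0).toNat = l1 + l2 - k0 := by rw [hl1, hl2, hk0]; omega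
  have t6 : (pOf a 2 + qOf a 1 - pOf a 0).toNat = k2 + l2 - k0 := by rw [hk2, hl2, hk0]; omega
  have t7 : (pOf a 0).toNat = k0 := by rw [hk0]; rfl
  have t8 : (pOf a 6).toNat = m₆ := by rw [hm]; rfl
  rw [t1, t2, t3, t4, t5, t6, t7, t8]
  push_cast at hJ ⊢
  linear_combination -hJ

/-- **(27) under `h` — the `h`-conjunct of the named Literature fact `invariance_of_converges'`, WITHOUT Bailey's
transformation and for EVERY pair `a`, `ha` of convergent exponents**: `I(ha)/∏_{i∈F} h_i(ha)! = I(a)/∏_{i∈F} h_i(a)!`.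
[BrownZudilin2022, Sect. 7, eq. (27) (generator `h`); RV §§2, 4] -/
theorem normalisedIntegral'_genH {a : Fin 8 → ℤ} (ha : Converges a) (hga : Converges (genH a)) :
    normalisedIntegral' (genH a) = normalisedIntegral' a := by
  have hI := cellularIntegral_genH ha hga
  have hP := normF_genH a
  have hc : (((qOf a 0).toNat.factorial * (qOf a 1).toNat.factorial * (pOf a 2).toNat.factorial *
      (pOf a 6 + qOf a 1 - pOf a 0).toNat.factorial : ℕ) : ℝ) ≠ 0 := by positivity
  unfold normalisedIntegral'
  rw [div_eq_div_iff (normF_pos _).ne' (normF_pos _).ne']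
  refine mul_right_cancel₀ hc ?_
  linear_combination ((Fset.map fun i => ((hForm a i).toNat.factorial : ℝ)).prod) * hI - cellularIntegral a * hP

end Summit.KontsevichZagierPeriods.Zeta5Search.JintegralH

end
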